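import Literature.AlgebraicGeometry.Motives.HodgeTensorFactsHolds
import Literature.AlgebraicGeometry.HodgeTheory.ComplexConjugationHolds
import Literature.AlgebraicGeometry.HodgeTheory.MonomialSupportedHypersurfaceMonodromy
import Literature.AlgebraicGeometry.HodgeTheory.MonomialSupportedHypersurfaceFamilyPoints
import Literature.AlgebraicGeometry.HodgeTheory.PolarizationFormMonodromyInvariant
import Literature.AlgebraicGeometry.HodgeTheory.HardLefschetzNFoldHolds
import Literature.AlgebraicGeometry.HodgeTheory.HolomorphicBundleChernCharacterProjectiveSpace
import Literature.AlgebraicGeometry.HodgeTheory.SupportedClassesRationalProofs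
import Literature.AlgebraicGeometry.HodgeTheory.HodgeFiltrationModelsReductionProofs
import Literature.AlgebraicGeometry.HodgeTheory.DiagonalSymmetryStability
import Literature.AlgebraicGeometry.Motives.HodgeDecompositionHardLefschetzDischarge
import Literature.AlgebraicGeometry.Motives.HypersurfaceFormsNonsingular
import Literature.AlgebraicGeometry.Deligne1982.SplitWeilTypeCMIsometry
import Literature.AlgebraicGeometry.HodgeTheory.SymmetricHypersurfaceInvolution
import HarnessLib

/-!
# K1-B piece FIB-coreB of crux `VeryGeneralSignCommutatorsInHg` (route `SignSymmetricPowers`,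
# item stmt-HodgeConjecture-19716): the fibre data of the ι-even family of quintic-space threefolds

Line `andre-zariski`, skeleton v12d (`23a5bf35595a68b5`; = v12c `6dad7c4c3cb7efaf` with the FIB piece re-cut), piece
`SignFibreCoreC` / registered stub `stub_signFibreCoreC` — LANDED BY NAME here.  Landed `--supports stmt-HodgeConjecture-19716` (it does not close the item).

For even `d ≥ 4` let `M = {m : |m| = d, m₀ + m₁ even}` (the ι-even monomials, `ι = diag(−1,−1,1,1,1)`),
`π_M = familyM ℂ 3 d M : 𝒴_M → S_M` the smooth projective family of smooth `M`-supported hypersurfaces of `ℙ⁴`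
(`Motives/MonomialSupportedHypersurfaceFamily`), `σ_t = sigmaMFiber … t` the relative sign involution on the
fibre `𝒴_t`, `τ = σ_t^*` on `H³(𝒴_t(ℂ); ℚ)`, `B = tr ∘ ∪` the light trace form of `𝒴_t`, and
`Γ_t = ratMonodromyGroup π_M 3 _ t` the rational monodromy group.

## What is proved

* §1 `hasHardLefschetzProperty_map_of_isClosedImmersion` — the hyperplane class `ι^* a` of a closed immersion
  `ι : X ⟶ ℙᴺ` of a smooth projective `X` has the hard Lefschetz property (a real multiple is Kähler,
  `Deligne1982.exists_isKaehlerClass_smul_map_ι`; `IsKaehlerClass.hasHardLefschetzProperty`);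
  `bettiCup_eq_of_isRatTransport` — for any family with a global class restricting to a hard Lefschetz class
  on the fibre, rational transports along a loop preserve cup products landing in the top degree (transport is
  multiplicative and trivial on `H²ⁿ`, `transportFun_eq_self_of_top`);
  **`cup_eq_of_mem_ratMonodromyGroup_familyM`** — hence `g x ∪ g y = x ∪ y` on `Hⁿ(𝒴_{M,t}; ℚ)` for every
  `g ∈ Γ_t`, every `n, d ≥ 1`, every `M` (the global class is the hyperplane class of `𝒴_M → 𝒴_U → ℙⁿ⁺¹`):
  the monodromy group preserves the intersection form, fact-free.
* §2 **`stub_signFibreCoreC`** — the REGISTERED stub of skeleton v12d (`23a5bf35595a68b5`): the v12c text of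
  `stub_signFibreCoreB` with its clause (φ-ii) `B x y = tr_{X_f}(φ x ∪ φ y)` replaced by
  `∃ c ≠ 0, B x y = c · tr_{X_f}(φ x ∪ φ y)`; all other clauses verbatim: `S_M` irreducible with a point (the Fermat form `Σ xᵢᵈ`), `FixesMonomials ℂ 3 d M ι`, Hodge models
  on the fibres (`realHodgeModel`), and at every admissible `f` (`t = classifyingPoint t₀ f`): `B` non-degenerate
  (`nondegenerate_tr_cup`), `τ² = 1` and `τ` a `B`-isometry (`σ_t = e ≫ diagonalAut f ≫ e⁻¹` for a fibre
  isomorphism `e : 𝒴_t ≅ X_f` compatible with `↪ ℙ⁴`, `sigmaMFiber_comp_eq_diagonalAut`, and the transport kit of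
  `BettiUniverseIsoTransport`), `Γ_t` commutes with `τ` (`ratMonodromyGroup_map_pull_sigmaMFiber`) and
  preserves `B` (§1), and `φ := (e⁻¹)^* = pullEquiv e 3` intertwines `τ` with `(diagonalAut f)^*`
  (`pullEquiv_pull_sigmaMFiber`), is a `tr ∘ ∪`-similitude (`exists_tr_comp_pull_eq_mul_of_iso`) and carries the
  Hodge group of the fibre's model Hodge structure into `Hg(H³(X_f))` (`mem_hodgeGroup_of_iso_of_hodgeModel`).

## Why the scalar

`BettiUniverse.tr hX 6` is the coordinate along a basis vector of the line `H⁶` CHOSEN per carrier type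
(`lineBasis`), so for `e : 𝒴_t ≅ X_f` only `tr_{𝒴_t} ∘ e^* = c · tr_{X_f}` with an opaque `c ≠ 0` holds; the
exact clause (φ-ii) of the registered text is therefore not provable in the tree (evidence memo
`FIBCOREB-MISSTATED-g2.md` on the item).  The scalar is harmless downstream: the seam rescales GEO's
existential `B` to `c⁻¹ • B` (isometry groups, orthogonality, links and `τ`-invariance are homogeneous;
transvection parameters rescale).

Sorry-free; axioms `propext`, `Classical.choice`, `Quot.sound`; no definition, no named fact.

## References

* [VoisinHodgeII2003] C. Voisin, Hodge Theory and Complex Algebraic Geometry II (CUP 2003), §3.1.2 (local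
  systems and monodromy), §3.2.3 (the monodromy preserves the intersection form), §6.2.1 (the universal family).
* [VoisinHodgeI2002] C. Voisin, Hodge Theory and Complex Algebraic Geometry I (CUP 2002), Thm. 6.25, Rem. 6.27,
  §7.1.2, §7.3.2, §9.2.1.
* [Deligne1982HodgeCycles] P. Deligne, Hodge cycles on abelian varieties, LNM 900 (1982), I Prop. 3.4.
* [HatcherAT2002] A. Hatcher, Algebraic Topology (CUP 2002), §3.2 Prop. 3.10, §3.3 Thm. 3.26.
* [Katz2009] N. M. Katz, Another look at the Dwork family (2009), §3.
-/

noncomputable section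

set_option linter.dupNamespace false

open CategoryTheory AlgebraicGeometry
open Literature.AlgebraicTopology.SingularHomology
open Literature.AlgebraicGeometry.Motives Literature.AlgebraicGeometry.Motives.UniversalHypersurface
open Literature.AlgebraicGeometry.HodgeTheory Literature.AlgebraicGeometry.HodgeTheory.UniversalHypersurface
open Literature.AlgebraicGeometry.HodgeTheory.BettiUniverse
open Literature.Geometry.Kaehler (HasHardLefschetzProperty)

namespace Summit.HodgeConjecture.HodgeConjecture.Theorems.SignSymmetricPowersFibreCoreB

/-! ### §1 The hyperplane class of a fibre has hard Lefschetz; monodromy preserves the cup product -/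

/-- For `N ≥ 1` there is a non-zero rational class in `H²(ℙᴺ(ℂ); ℂ)` (the group is a line spanned by its
rational classes). [cite: HatcherAT2002, Thm. 3.19] -/
theorem exists_isRationalClass_ne_zero_projectiveSpace_two {N : ℕ} (hN : 1 ≤ N) :
    ∃ r₀ : complexBetti (projectiveSpace N ℂ) 2, IsRationalClass r₀ ∧ r₀ ≠ 0 := by
  have hP : IsSmoothProjective N (projectiveSpace N ℂ) := isSmoothProjective_projectiveSpace' N
  have h1 : Module.finrank ℂ (complexBetti (projectiveSpace N ℂ) 2) = 1 :=
    finrank_complexBetti_projectiveSpace_two_mul_eq_one N (p := 1) hN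
  have hspan := span_isRationalClass_eq_top_of_isSmoothProjective_holds N (projectiveSpace N ℂ) hP 2
  by_contra hcon
  have hbot : Submodule.span ℂ {c : complexBetti (projectiveSpace N ℂ) 2 | IsRationalClass c} = ⊥ :=
    Submodule.span_eq_bot.2 fun c hc ↦ by_contra fun h0 ↦ hcon ⟨c, hc, h0⟩
  rw [hspan] at hbot
  haveI : Subsingleton (complexBetti (projectiveSpace N ℂ) 2) :=
    subsingleton_of_forall_eq 0 fun c ↦ (Submodule.mem_bot ℂ).1 (hbot ▸ Submodule.mem_top)
  rw [Module.finrank_zero_of_subsingleton] at h1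
  exact zero_ne_one h1

/-- **The hyperplane class of a projective embedding has the hard Lefschetz property**: for a closed
immersion `ι : X ⟶ ℙᴺ` of a smooth projective `X` of dimension `m + 1` and a non-zero rational
`a ∈ H²(ℙᴺ(ℂ); ℂ)`, `ι^* a` has the hard Lefschetz property (a non-zero real multiple of it is a Kähler
class, `Deligne1982.exists_isKaehlerClass_smul_map_ι`; Kähler classes satisfy hard Lefschetz,
`IsKaehlerClass.hasHardLefschetzProperty`; hard Lefschetz is invariant under non-zero scalars).
[cite: VoisinHodgeI2002, Thm. 6.25, Rem. 6.27 and §7.1.2] -/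
theorem hasHardLefschetzProperty_map_of_isClosedImmersion {m : ℕ} {X : SchemeOver ℂ}
    (hX : IsSmoothProjective (m + 1) X) {N : ℕ} (ι : X ⟶ projectiveSpace N ℂ) [IsClosedImmersion ι.left]
    {a : complexBetti (projectiveSpace N ℂ) 2} (ha : IsRationalClass a) (ha0 : a ≠ 0) :
    HasHardLefschetzProperty (complexBetti.map ι 2 a) (m + 1) := by
  obtain ⟨s, hs0, hK⟩ := Literature.AlgebraicGeometry.Deligne1982.exists_isKaehlerClass_smul_map_ι hX ⟨N, ι, inferInstance⟩ ha ha0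
  have hL := hK.hasHardLefschetzProperty hX fun _ ↦ hasHardLefschetzProperty_kaehlerClass_holds
  have h := HasHardLefschetzProperty.smul hL (w := ((s : ℂ))⁻¹) (inv_ne_zero (Complex.ofReal_ne_zero.2 hs0))
  rwa [smul_smul, inv_mul_cancel₀ (Complex.ofReal_ne_zero.2 hs0), one_smul] at h


/-- **Monodromy preserves cup products landing in the top degree.** For a family `f : 𝒳 ⟶ S`
cohomologically locally trivial over `U`, a global class `K ∈ H²(𝒳(ℂ); ℂ)` whose restriction to the smooth
projective `n`-dimensional fibre `X_s` has the hard Lefschetz property, and rational transports `T_p`, `T_q`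
(degrees `p + q = 2n`) along one loop at `s`: `T_p x ∪ T_q y = x ∪ y` in `H²ⁿ(X_s(ℂ); ℚ)` — transport is
multiplicative (`transportFun_cupProduct`) and acts trivially on `H²ⁿ` (`transportFun_eq_self_of_top`).
[cite: VoisinHodgeII2003, §3.1.2] [cite: VoisinHodgeI2002, Thm. 6.25 and §9.2.1] -/
theorem bettiCup_eq_of_isRatTransport {𝒳 S : SchemeOver ℂ} (f : 𝒳 ⟶ S) {U : Set (ComplexPoints S)}
    (hU : IsCohomologicallyLocallyTrivialOn f U) (K : complexBetti 𝒳 2) {n : ℕ} {s : U}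
    (hXs : IsSmoothProjective n (fiberOver f s.1))
    (hL : HasHardLefschetzProperty (complexBetti.map (fiberι f s.1) 2 K) n)
    (γ : Path.Homotopic.Quotient s s) {p q r : ℕ} (hr : r = 2 * n) (h : p + q = r)
    {Tp : bettiCohomology (fiberOver f s.1) p ≃ₗ[ℚ] bettiCohomology (fiberOver f s.1) p}
    {Tq : bettiCohomology (fiberOver f s.1) q ≃ₗ[ℚ] bettiCohomology (fiberOver f s.1) q}
    (hTp : IsRatTransport f p hU γ Tp) (hTq : IsRatTransport f q hU γ Tq)
    (x : bettiCohomology (fiberOver f s.1) p) (y : bettiCohomology (fiberOver f s.1) q) :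
    bettiCup h (Tp x) (Tq y) = bettiCup h x y := by
  subst hr
  have hrat : ∀ (a : bettiCohomology (fiberOver f s.1) p) (b : bettiCohomology (fiberOver f s.1) q),
      ofRatClass (ComplexPoints (fiberOver f s.1)) (2 * n) (bettiCup h a b) =
        cupProduct h (ofRatClass _ p a) (ofRatClass _ q b) := fun a b ↦ by
    rw [ofRatClass_eq_ringChange, ofRatClass_eq_ringChange, ofRatClass_eq_ringChange]
    exact singularCohomology.ringChange_cupProduct _ h a b
  apply ofRatClass_injective
  rw [hrat, hrat, hTp x, hTq y, ← transportFun_cupProduct f hU h γ,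
    transportFun_eq_self_of_top f hU K hXs hL γ]

/-- **The monodromy group of the `M`-supported family preserves the middle cup product**: for
`n, d ≥ 1`, `t ∈ S_M(ℂ)` in a cohomologically locally trivial `U` and `g ∈ Γ_t = ratMonodromyGroup π_M n _ t`,
`g x ∪ g y = x ∪ y` in `H²ⁿ(𝒴_{M,t}(ℂ); ℚ)`. The global class is the hyperplane class of
`𝒴_M → 𝒴_U → ℙⁿ⁺¹`; its restriction to the fibre `𝒴_{M,t} ≅ X_{F_t} ⊂ ℙⁿ⁺¹` is the hyperplane class of a
projective embedding, which has the hard Lefschetz property. In particular `Γ_t` preserves the trace form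
`tr ∘ ∪`. [cite: VoisinHodgeII2003, §3.1.2 and §3.2.3 (the monodromy preserves the intersection form)] -/
theorem cup_eq_of_mem_ratMonodromyGroup_familyM (n d : ℕ) (M : Set (DegIndex n d)) (hn : 1 ≤ n)
    (hd : 1 ≤ d) {U : Set (ComplexPoints (baseM ℂ n d M))}
    (hU : IsCohomologicallyLocallyTrivialOn (familyM ℂ n d M) U) (s : U)
    {g : bettiCohomology (fiberOver (familyM ℂ n d M) s.1) n ≃ₗ[ℚ]
      bettiCohomology (fiberOver (familyM ℂ n d M) s.1) n}
    (hg : g ∈ ratMonodromyGroup (familyM ℂ n d M) n hU s)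
    (x y : bettiCohomology (fiberOver (familyM ℂ n d M) s.1) n) :
    cup (fiberOver (familyM ℂ n d M) s.1) n n (g x) (g y) = cup (fiberOver (familyM ℂ n d M) s.1) n n x y := by
  obtain ⟨γ, hγ⟩ := hg
  obtain ⟨a, ha, ha0⟩ := exists_isRationalClass_ne_zero_projectiveSpace_two (N := n + 1) (by omega)
  obtain ⟨m, rfl⟩ : ∃ m, n = m + 1 := ⟨n - 1, by omega⟩
  -- the fibre is a closed subvariety of `ℙⁿ⁺¹`
  obtain ⟨e, he⟩ := exists_fiberIsoM_comp_hypersurfaceι ℂ (m + 1) d M (by omega) s.1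
  haveI : IsIso e.hom.left := inferInstance
  haveI : IsClosedImmersion (fiberToProjectiveSpace ℂ (m + 1) d M s.1).left := by
    rw [← he, Over.comp_left]
    infer_instance
  have hXs : IsSmoothProjective (m + 1) (fiberOver (familyM ℂ (m + 1) d M) s.1) :=
    isSmoothProjective_fiberOver_familyM ℂ (m + 1) d M hn hd s.1
  have hL := hasHardLefschetzProperty_map_of_isClosedImmersion hXs
    (fiberToProjectiveSpace ℂ (m + 1) d M s.1) ha ha0
  have hK : complexBetti.map (fiberι (familyM ℂ (m + 1) d M) s.1) 2
      (complexBetti.map (totalMToTotal ℂ (m + 1) d M ≫ UniversalHypersurface.toProjectiveSpace ℂ (m + 1) d) 2 a) =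
      complexBetti.map (fiberToProjectiveSpace ℂ (m + 1) d M s.1) 2 a := by
    rw [← CategoryTheory.comp_apply, ← complexBetti.map_comp]
  rw [← hK] at hL
  exact bettiCup_eq_of_isRatTransport (familyM ℂ (m + 1) d M) hU _ hXs hL γ (two_mul (m + 1)).symm rfl
    hγ hγ x y


/-! ### §2 FIB-coreB with the trace-scalar: the fibre data of the ι-even family -/

/-- The Fermat form `Σᵢ xᵢᵈ` has only the coefficients `e = d·δᵢ`; in particular it is `ι`-even
(`coeff_e = 0` unless `e₀ + e₁` is even) when `d` is even. [folklore] -/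
theorem coeff_sum_X_pow_eq_zero_of_not_even {d : ℕ} (hd : Even d) (e : Fin 5 →₀ ℕ)
    (he : ¬ Even (e 0 + e 1)) :
    (∑ i : Fin 5, (MvPolynomial.X i : MvPolynomial (Fin 5) ℂ) ^ d).coeff e = 0 := by
  classical
  rw [MvPolynomial.coeff_sum]
  refine Finset.sum_eq_zero fun i _ => ?_
  rw [MvPolynomial.coeff_X_pow, if_neg]
  rintro rfl
  apply he
  simp only [Finsupp.single_apply]
  split_ifs <;> simp [hd]


/-- **`stub_signFibreCoreC`** (registered stub of the K1-B line `andre-zariski`, skeleton v12d, signature verbatim) — the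
v12c piece `stub_signFibreCoreB` with its clause (φ-ii) stated UP TO THE TRACE SCALAR: `∃ c ≠ 0, B x y = c · tr_{X_f}(φ x ∪ φ y)` (the light trace
`BettiUniverse.tr` is normalised independently on `H⁶(𝒴_t)` and `H⁶(X_f)`, so `c = 1` is not available,
`exists_tr_comp_pull_eq_mul_of_iso`). Everything else verbatim: the base `S_M` of smooth ι-even forms is
irreducible and has a point (the Fermat form), `ι = diag(−1,−1,1,1,1)` fixes the monomials of `M`, Hodge models
on all fibres, and at every admissible `f`: `B = tr ∘ ∪` non-degenerate, `τ = σ_t^*` an involutive `B`-isometry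
commuting with the monodromy group `Γ_t`, `Γ_t` preserves `B` (`cup_eq_of_mem_ratMonodromyGroup_familyM`), and
`φ = (e⁻¹)^*` for a fibre isomorphism `e : 𝒴_t ≅ X_f` compatible with `↪ ℙ⁴` intertwines `τ` with
`(diagonalAut f)^*`, is a `tr ∘ ∪`-similitude and transports Hodge groups. [cite: VoisinHodgeII2003, §3.1.2 and §6.2.1]
[cite: Deligne1982HodgeCycles, I Prop. 3.4] -/
theorem stub_signFibreCoreC :
    open Literature.AlgebraicGeometry.Motives Literature.AlgebraicGeometry.Motives.UniversalHypersurface Literature.AlgebraicGeometry.HodgeTheory Literature.AlgebraicGeometry.HodgeTheory.UniversalHypersurface Literature.AlgebraicGeometry.HodgeTheory.BettiUniverse CategoryTheory.Limits in ∀ ⦃d : ℕ⦄, Even d → ∀ (h4 : 4 ≤ d), (let M : Set (DegIndex 3 d) := {m | Even (m.1 0 + m.1 1)}; let γ : Fin 5 → ℂˣ := fun i => if (i : ℕ) < 2 then -1 else 1; let u := familyM ℂ 3 d M; let hu : IsSmoothProjectiveFamily u 3 := isSmoothProjectiveFamily_familyM ℂ 3 d M (by decide) (le_trans (by decide) h4);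 let hU : IsCohomologicallyLocallyTrivialOn u (Set.univ : Set (ComplexPoints (baseM ℂ 3 d M))) := isCohomologicallyLocallyTrivialOn_familyM 3 d M (by decide) (le_trans (by decide) h4); IrreducibleSpace (baseM ℂ 3 d M).left ∧ Nonempty (ComplexPoints (baseM ℂ 3 d M)) ∧ FixesMonomials ℂ 3 d M γ ∧ ∃ (A : ∀ s : ComplexPoints (baseM ℂ 3 d M), HodgeModel 3 (fiberOver u s)) (hA : ∀ s, (A s).IsHodgeSymmetric), ∀ (hγ : FixesMonomials ℂ 3 d M γ) (t₀ : ComplexPoints (baseM ℂ 3 d M)) (f : MvPolynomial (Fin 5) ℂ) (hf : f.IsHomogeneous d) (hM : IsSupportedOn 3 d M f) (hJ : SmoothHypersurface.IsNonsingularForm ℂ f), let t := classifyingPoint ℂ 3 d M t₀ f; let Y := fiberOver u t; let hY : IsSmoothProjective 3 Y := hu.isSmoothProjective t; let B : LinearMap.BilinForm ℚ (bettiCohomology Y 3) := (cup Y 3 3).compr₂ (tr hY (3 + 3)); let τ : bettiCohomology Y 3 →ₗ[ℚ] bettiCohomology Y 3 := pull (sigmaMFiber ℂ 3 d M γ hγ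 t) 3; let Γ := (haveI := finite hY 3; ratMonodromyGroup u 3 hU ⟨t, Set.mem_univ _⟩); ∀ (hXF : IsSmoothProjective 3 (SmoothHypersurface.hypersurface f)) (ha : γ ∈ diagonalStabilizer f), B.Nondegenerate ∧ τ ^ 2 = 1 ∧ (∀ x y, B (τ x) (τ y) = B x y) ∧ (∀ g ∈ Γ, ∀ x, g (τ x) = τ (g x)) ∧ (∀ g ∈ Γ, ∀ x y, B (g x) (g y) = B x y) ∧ ∃ φ : bettiCohomology Y 3 ≃ₗ[ℚ] bettiCohomology (SmoothHypersurface.hypersurface f) 3, (∀ x, φ (τ x) = pull (diagonalAut f ha) 3 (φ x)) ∧ (∃ c : ℚ, c ≠ 0 ∧ ∀ x y, B x y = c * tr hXF (3 + 3) (cup (SmoothHypersurface.hypersurface f) 3 3 (φ x) (φ y))) ∧ (haveI : HodgeTensorFacts.{0, 0} := hodgeTensorFacts_holds; haveI := finite hXF 3; haveI := finite hY 3; ∀ k : bettiCohomology Y 3 ≃ₗ[ℚ] bettiCohomology Y 3, k ∈ ((A t).hodgeStructure hY (hA t) 3).hodgeGroup → (φ.symm.trans k).trans φ ∈ (hodge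 exists_isReal_hodgeModel_holds hXF 3).hodgeGroup)) := by
  intro d hd h4 M γ u hu hU
  have hd1 : 1 ≤ d := le_trans (by decide) h4
  -- the Fermat form `Σ xᵢᵈ` is a smooth ι-even member
  have hΦhom : (∑ i : Fin 5, (MvPolynomial.X i : MvPolynomial (Fin 5) ℂ) ^ d).IsHomogeneous d :=
    MvPolynomial.IsHomogeneous.sum _ _ _ fun i _ => by simpa using (MvPolynomial.isHomogeneous_X ℂ i).pow d
  have hΦJ : SmoothHypersurface.IsNonsingularForm ℂ (∑ i : Fin 5, (MvPolynomial.X i : MvPolynomial (Fin 5) ℂ) ^ d) :=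
    SmoothHypersurface.isNonsingularForm_sum_X_pow (n := 3) (by exact_mod_cast (show d ≠ 0 by omega))
  have hΦM : IsSupportedOn 3 d M (∑ i : Fin 5, (MvPolynomial.X i : MvPolynomial (Fin 5) ℂ) ^ d) :=
    fun m hm => coeff_sum_X_pow_eq_zero_of_not_even hd m.1 hm
  have hγM : FixesMonomials ℂ 3 d M γ := by
    intro m hm
    have hm' : Even (m.1 0 + m.1 1) := hm
    rw [unitWeight, Finsupp.prod_fintype _ _ (fun i => by simp), Fin.prod_univ_five]
    simp only [γ, Fin.val_zero, Fin.val_one, Fin.val_two, Nat.zero_lt_two, Nat.one_lt_two, if_true,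
      show ¬ ((2 : ℕ) < 2) by omega, show ¬ ((3 : Fin 5) : ℕ) < 2 by decide,
      show ¬ ((4 : Fin 5) : ℕ) < 2 by decide, if_false, one_pow, mul_one, ← pow_add]
    exact hm'.neg_one_pow
  refine ⟨irreducibleSpace_baseM_left_of_form ℂ 3 d M hΦhom hΦJ hΦM, ⟨pointOfFormM ℂ 3 d M hΦhom hΦJ hΦM⟩, hγM,
    fun s => realHodgeModel exists_isReal_hodgeModel_holds (hu.isSmoothProjective s),
    fun s => realHodgeModel_isHodgeSymmetric exists_isReal_hodgeModel_holds (hu.isSmoothProjective s), ?_⟩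
  intro hγ t₀ f hf hM hJ t Y hY B τ Γ hXF ha
  -- the fibre over the classifying point of `f` is `X_f`, compatibly with `↪ ℙ⁴`
  have hFt : pointFormM ℂ 3 d M t = f := by
    have ht : t = pointOfFormM ℂ 3 d M hf hJ hM := classifyingPoint_eq ℂ 3 d M t₀ hf hJ hM
    rw [ht]
    exact pointFormM_pointOfFormM ℂ 3 d M hf hJ hM
  obtain ⟨e, he⟩ : ∃ e : Y ≅ SmoothHypersurface.hypersurface f,
      e.hom ≫ SmoothHypersurface.hypersurfaceι f = fiberToProjectiveSpace ℂ 3 d M t := by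
    have h := exists_fiberIsoM_comp_hypersurfaceι ℂ 3 d M (by omega) t
    rw [hFt] at h
    exact h
  -- the deck of the fibre is the conjugate of `diagonalAut f`
  have hconj : sigmaMFiber ℂ 3 d M γ hγ t = e.hom ≫ diagonalAut f ha ≫ e.inv := by
    rw [← Category.assoc, ← sigmaMFiber_comp_eq_diagonalAut 3 d M γ hγ t e he ha, Category.assoc,
      e.hom_inv_id, Category.comp_id]
  have hτ : τ = pull (e.hom ≫ diagonalAut f ha ≫ e.inv) 3 := by
    show pull (sigmaMFiber ℂ 3 d M γ hγ t) 3 = _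
    rw [hconj]
  have hγ2 : γ * γ = 1 := by
    funext i
    simp only [γ, Pi.mul_apply, Pi.one_apply]
    split_ifs <;> simp
  have h1 : pull (diagonalAut f ha) 3 ^ 2 = 1 := pull_diagonalAut_sq_eq_one (n := 3) f ha hγ2 3
  have h2 : ∀ x y, tr hXF (3 + 3) (cup (SmoothHypersurface.hypersurface f) 3 3 (pull (diagonalAut f ha) 3 x)
      (pull (diagonalAut f ha) 3 y)) = tr hXF (3 + 3) (cup (SmoothHypersurface.hypersurface f) 3 3 x y) :=
    fun x y => tr_cup_pull_diagonalAut (n := 3) f hXF ha 3 3 x y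
  refine ⟨nondegenerate_tr_cup hY, ?_, ?_, ?_, ?_, ?_⟩
  · -- `τ² = 1`
    rw [hτ]
    exact pull_conj_sq_eq_one_of_iso e h1
  · -- `τ` is a `B`-isometry
    intro x y
    show tr hY (3 + 3) (cup Y 3 3 (τ x) (τ y)) = tr hY (3 + 3) (cup Y 3 3 x y)
    rw [hτ]
    exact tr_cup_pull_conj_of_iso hY hXF e h2 x y
  · -- `Γ` commutes with `τ`
    intro g hg x
    exact ratMonodromyGroup_map_pull_sigmaMFiber 3 d M γ 3 hU hγ ⟨t, Set.mem_univ _⟩ hg x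
  · -- `Γ` preserves `B`
    intro g hg x y
    show tr hY (3 + 3) (cup Y 3 3 (g x) (g y)) = tr hY (3 + 3) (cup Y 3 3 x y)
    rw [cup_eq_of_mem_ratMonodromyGroup_familyM 3 d M (by decide) hd1 hU ⟨t, Set.mem_univ _⟩ hg x y]
  · -- the fibre identification `φ = (e⁻¹)^*`
    refine ⟨pullEquiv e 3, fun x => pullEquiv_pull_sigmaMFiber 3 d M γ hγ t e he ha 3 x, ?_, ?_⟩
    · obtain ⟨c, hc, hce⟩ := exists_tr_comp_pull_eq_mul_of_iso hY hXF e
      refine ⟨c, hc, fun x y => ?_⟩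
      show tr hY (3 + 3) (cup Y 3 3 x y) = _
      conv_lhs => rw [← pull_hom_pull_inv_apply e 3 x, ← pull_hom_pull_inv_apply e 3 y, ← pull_cup, hce]
      rfl
    · intro k hk
      haveI : HodgeTensorFacts.{0, 0} := hodgeTensorFacts_holds
      haveI := finite hY 3
      exact mem_hodgeGroup_of_iso_of_hodgeModel exists_isReal_hodgeModel_holds
        hodgePQ_independent_of_hodgeModel_holds hY hXF e _ _ 3 k hk

end Summit.HodgeConjecture.HodgeConjecture.Theorems.SignSymmetricPowersFibreCoreB

end
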